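import Literature.NumberTheory.Irrationality.Zudilin2004.Lemma19Bricks
import Literature.NumberTheory.Transcendental.ZudilinCoefficients
import HarnessLib

/-!
# Zudilin 2004, Lemma 19 for general `𝐡`, III: the partial-fraction coefficients `B_{jk}` and their symmetry

Topic `Literature/NumberTheory/Irrationality/Zudilin2004`. Third file of the discharge of
`Literature.NumberTheory.Irrationality.Zudilin2004.lemma19`, following [Zudilin2004, §8, proof of Lemma 19]
(arXiv:math/0206176 pp. 19–20). For a valid parameter set `P = (q, r, 𝐡)`:

* `HParams.poleSet P = [h_{r+1}, h₀ − h_{r+1}]` (the pole indices `k` of `R(t)`), and the coefficients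
  `HParams.B P s k = (1/(q−r−s)!)(R(t)(t+k)^{q−r})^{(q−r−s)}|_{t=−k}` (`= B_{jk}` of the printed proof with
  `j = s + r`, `1 ≤ s ≤ q − r`), as divided derivatives of the regularised product `Gk P k` of `Lemma19Bricks.lean`;
* `HParams.RwpQ_eq_sum_B` — the expansion `R(t) = Σ_{j=r+1}^{q} Σ_k B_{jk}/(t+k)^{j−r}`, i.e.
  `R(t) = Σ_{k ∈ poleSet} Σ_{s=1}^{q−r} B P s k · (t+k)^{−s}` away from the poles: EXISTENCE of such an expansion is
  `PartialFractions.exists_pfEval_eq_eval_mul_prod_inv` (the numerator of `R` has degree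
  `1 + 2Σ_{j≤r}(h_j−1) <` the number `Σ_{j>r}(h₀−2h_j+1)` of linear factors of the denominator — this is where
  (8.1) enters, `HParams.natDegree_add_two_le_length`), and the coefficients are IDENTIFIED with the `B P s k` by
  comparing germs at `−k` (`HParams.divDeriv_Gk_eq_coeff`; the same scheme as the tree's Theorem-3 instance
  `Transcendental/ZudilinCoefficients.lean`, whose elementary `contDiffAt_inv_pow` is reused);
* `HParams.RwpQ_reflect` — the well-poised symmetry (8.5) `R(−t−h₀) = −R(t)`; hence
  `HParams.B_symm : B P s (h₀−k) = (−1)^{s+1} B P s k` (printed: `B_{jk} = (−1)^j B_{j,h₀−k}`, `r` odd) and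
  `HParams.sum_B_eq_zero_of_even : Σ_k B P s k = 0` for even `s` (printed: `A_{j−1} = 0` for odd `j`, (8.12)).

Everything here is PROVED (no named facts).

## References

* [Zudilin2004] W. Zudilin, *Arithmetic of linear forms involving odd zeta values*, J. Théor. Nombres Bordeaux
  16 (2004), 251–291 = arXiv:math/0206176, §8 (8.1), (8.5), (8.7), proof of Lemma 19 ((8.12)).
-/

noncomputable section

open Finset Filter Topology Polynomial Literature.Analysis.Calculus
open scoped Nat

namespace Literature.NumberTheory.Irrationality.Zudilin2004

open Literature.NumberTheory.Transcendental

namespace HParams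

variable (P : HParams)

/-! ### Poles and coefficients -/

/-- The set of pole indices `k` of `R(t)`: `h_{r+1} ≤ k ≤ h₀ − h_{r+1}` (poles at `t = −k`).
[cite: Zudilin2004, §8 Lemma 19 (proof)] -/
def poleSet : Finset ℕ := Icc (P.h (P.r + 1)) (P.h 0 - P.h (P.r + 1))

/-- **The coefficients** `B P s k = (1/(q−r−s)!)(R(t)(t+k)^{q−r})^{(q−r−s)}|_{t=−k}` (`= B_{jk}`, `j = s + r`),
as divided derivatives of the regularised product `Gk P k`. [cite: Zudilin2004, §8 Lemma 19 (proof)] -/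
def B (s k : ℕ) : ℚ := divDeriv (P.q - P.r - s) (P.Gk k) (-(k : ℚ))

variable {P} in
/-- The reflection `k ↦ h₀ − k` preserves the pole set. [cite: Zudilin2004, §8 (8.5)] -/
theorem reflect_mem_poleSet {k : ℕ} (hk : k ∈ P.poleSet) : P.h 0 - k ∈ P.poleSet := by
  have := mem_Icc.1 hk
  exact mem_Icc.2 ⟨by omega, by omega⟩

/-! ### `R(t)` as `numPoly(t) · ∏ (t+i)⁻¹` -/

/-- The numerator polynomial of `R(t)`:
`(h₀ + 2X) ∏_{j≤r} [∏_{i=1}^{h_j−1}(X+i)/(h_j−1)!] ∏_{j≤r} [∏_{i=1}^{h_j−1}(X+(h₀−h_j)+i)/(h_j−1)!] ∏_{j>r}(h₀−2h_j)!`.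
[cite: Zudilin2004, §8 (8.7)] -/
def numPoly : ℚ[X] :=
  (C 2 * X + C (P.h 0 : ℚ)) *
    (∏ j ∈ Icc 1 P.r, (∏ i ∈ Icc 1 (P.h j - 1), (X + C (i : ℚ))) * C (((P.h j - 1)! : ℚ)⁻¹)) *
    (∏ j ∈ Icc 1 P.r,
      (∏ i ∈ Icc 1 (P.h j - 1), (X + C ((P.h 0 - P.h j : ℕ) : ℚ) + C (i : ℚ))) * C (((P.h j - 1)! : ℚ)⁻¹)) *
    C (∏ j ∈ Icc (P.r + 1) P.q, ((P.h 0 - 2 * P.h j)! : ℚ))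

/-- The list of shifts `h_j + i` (`j > r`, `0 ≤ i ≤ h₀ − 2h_j`) of the linear factors of the denominator of
`R(t)`, with multiplicity. [cite: Zudilin2004, §8 (8.7)] -/
def denList : List ℕ :=
  (Icc (P.r + 1) P.q).toList.flatMap fun j => ((Icc 0 (P.h 0 - 2 * P.h j)).toList.map fun i => P.h j + i)

/-- `deg numPoly ≤ 1 + 2 Σ_{j≤r} (h_j − 1)`. [cite: Zudilin2004, §8 (8.3)] -/
theorem natDegree_numPoly_le :
    P.numPoly.natDegree ≤ 1 + (∑ j ∈ Icc 1 P.r, (P.h j - 1)) + ∑ j ∈ Icc 1 P.r, (P.h j - 1) := by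
  unfold numPoly
  have h1 : (C (2 : ℚ) * X + C (P.h 0 : ℚ)).natDegree ≤ 1 := natDegree_linear_le
  have hA : (∏ j ∈ Icc 1 P.r, (∏ i ∈ Icc 1 (P.h j - 1), (X + C (i : ℚ))) * C (((P.h j - 1)! : ℚ)⁻¹)).natDegree
      ≤ ∑ j ∈ Icc 1 P.r, (P.h j - 1) := by
    refine (natDegree_prod_le _ _).trans (sum_le_sum fun j _ => ?_)
    refine (natDegree_mul_C_le _ _).trans ((natDegree_prod_le _ _).trans ?_)
    simp only [natDegree_X_add_C, sum_const, smul_eq_mul, mul_one, Nat.card_Icc]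
    omega
  have hB : (∏ j ∈ Icc 1 P.r, (∏ i ∈ Icc 1 (P.h j - 1), (X + C ((P.h 0 - P.h j : ℕ) : ℚ) + C (i : ℚ))) *
      C (((P.h j - 1)! : ℚ)⁻¹)).natDegree ≤ ∑ j ∈ Icc 1 P.r, (P.h j - 1) := by
    refine (natDegree_prod_le _ _).trans (sum_le_sum fun j _ => ?_)
    refine (natDegree_mul_C_le _ _).trans ((natDegree_prod_le _ _).trans ?_)
    have : ∀ i ∈ Icc 1 (P.h j - 1), (X + C ((P.h 0 - P.h j : ℕ) : ℚ) + C (i : ℚ)).natDegree = 1 := by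
      intro i _
      rw [add_assoc, ← C_add, natDegree_X_add_C]
    rw [sum_congr rfl this]
    simp only [sum_const, smul_eq_mul, mul_one, Nat.card_Icc]
    omega
  refine ((natDegree_mul_C_le _ _).trans (natDegree_mul_le.trans (add_le_add (natDegree_mul_le.trans
    (add_le_add h1 hA)) hB))).trans le_rfl

/-- `|denList| = Σ_{j>r} (h₀ − 2h_j + 1)`. [cite: Zudilin2004, §8 (8.7)] -/
theorem length_denList : P.denList.length = ∑ j ∈ Icc (P.r + 1) P.q, (P.h 0 - 2 * P.h j + 1) := by
  unfold denList
  rw [List.length_flatMap]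
  have : ((Icc (P.r + 1) P.q).toList.map fun j =>
      (((Icc 0 (P.h 0 - 2 * P.h j)).toList.map fun i => P.h j + i).length))
      = (Icc (P.r + 1) P.q).toList.map fun j => P.h 0 - 2 * P.h j + 1 := by
    refine List.map_congr_left fun j _ => ?_
    rw [List.length_map, Finset.length_toList, Nat.card_Icc]
    omega
  rw [this, Finset.sum_map_toList]

variable {P} in
/-- **(8.1) ⇒ `R(t) = O(t⁻²)`** ((8.3)): `deg numPoly + 2 ≤ |denList|`. [cite: Zudilin2004, §8 (8.1), (8.3)] -/
theorem natDegree_add_two_le_length (hV : P.Valid) : P.numPoly.natDegree + 2 ≤ P.denList.length := by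
  have hrq := hV.r_add_four_le
  have h81 := hV.two_mul_sum_le
  rw [length_denList]
  refine (Nat.add_le_add_right P.natDegree_numPoly_le 2).trans ?_
  -- `Σ_{j≤r}(h_j − 1) = S₁ − r`, `Σ_{j>r}(h₀−2h_j+1) = (q−r)(h₀+1) − 2S₂`, `S₁ + S₂ = Σ_{j≤q} h_j`
  have hS1 : ∑ j ∈ Icc 1 P.r, (P.h j - 1) = (∑ j ∈ Icc 1 P.r, P.h j) - P.r := by
    rw [sum_tsub_distrib _ fun j hj => hV.one_le_h (j := j) (by have := mem_Icc.1 hj; omega)]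
    simp
  have hS2 : ∑ j ∈ Icc (P.r + 1) P.q, (P.h 0 - 2 * P.h j + 1)
      = (P.q - P.r) * (P.h 0 + 1) - ∑ j ∈ Icc (P.r + 1) P.q, 2 * P.h j := by
    have e : ∀ j ∈ Icc (P.r + 1) P.q, P.h 0 - 2 * P.h j + 1 = (P.h 0 + 1) - 2 * P.h j := by
      intro j hj
      have := hV.two_mul_h_lt (j := j) (by have := mem_Icc.1 hj; omega) (mem_Icc.1 hj).2
      omega
    rw [sum_congr rfl e, sum_tsub_distrib _ fun j hj =>
      (hV.two_mul_h_lt (j := j) (by have := mem_Icc.1 hj; omega) (mem_Icc.1 hj).2).le.trans (by omega)]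
    simp only [sum_const, smul_eq_mul, Nat.card_Icc]
    congr 1
    rw [show P.q + 1 - (P.r + 1) = P.q - P.r by omega]
  have hsplit : ∑ j ∈ Icc 1 P.q, P.h j = ∑ j ∈ Icc 1 P.r, P.h j + ∑ j ∈ Icc (P.r + 1) P.q, P.h j := by
    rw [← sum_union]
    · congr 1
      ext j
      simp only [mem_Icc, mem_union]
      omega
    · rw [disjoint_left]
      intro j hj hj'
      have := mem_Icc.1 hj
      have := mem_Icc.1 hj'
      omega
  have hr1 : P.r ≤ ∑ j ∈ Icc 1 P.r, P.h j := by
    have := sum_le_sum (s := Icc 1 P.r) (f := fun _ => 1) (g := fun j => P.h j)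
      fun j hj => hV.one_le_h (j := j) (by have := mem_Icc.1 hj; omega)
    simpa using this
  have h2 : ∑ j ∈ Icc (P.r + 1) P.q, 2 * P.h j = 2 * ∑ j ∈ Icc (P.r + 1) P.q, P.h j := by
    rw [mul_sum]
  rw [hS1, hS2, h2]
  rw [hsplit] at h81
  have e3 : (P.q - P.r) * (P.h 0 + 1) = P.h 0 * (P.q - P.r) + (P.q - P.r) := by ring
  rw [e3]
  omega

/-- `R(t) = numPoly(t) · ∏_{i ∈ denList} (t+i)⁻¹`. [cite: Zudilin2004, §8 (8.7)] -/
theorem RwpQ_eq_eval_mul_prod (t : ℚ) :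
    P.RwpQ t = P.numPoly.eval t * (P.denList.map fun i : ℕ => (t + (i : ℚ))⁻¹).prod := by
  have hprod : (P.denList.map fun i : ℕ => (t + (i : ℚ))⁻¹).prod
      = ∏ j ∈ Icc (P.r + 1) P.q, ∏ i ∈ Icc 0 (P.h 0 - 2 * P.h j), (t + P.h j + (i : ℚ))⁻¹ := by
    unfold denList
    rw [List.map_flatMap, List.flatMap_def, List.prod_flatten, List.map_map, ← Finset.prod_map_toList]
    refine congrArg List.prod (List.map_congr_left fun j _ => ?_)
    simp only [Function.comp_def, List.map_map]
    rw [Finset.prod_map_toList]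
    refine prod_congr rfl fun i _ => ?_
    push_cast
    ring
  rw [hprod, RwpQ, numPoly]
  simp only [eval_mul, eval_C, eval_add, eval_X, eval_prod]
  simp only [div_eq_mul_inv, prod_mul_distrib, prod_inv_distrib]
  ring

/-! ### Existence of an expansion with poles of order `≤ q − r` -/

variable {P}

/-- Every shift in `denList` is a pole index. [cite: Zudilin2004, §8 Lemma 19 (proof)] -/
theorem mem_poleSet_of_mem_denList (hV : P.Valid) {i : ℕ} (h : i ∈ P.denList) : i ∈ P.poleSet := by
  have hrq := hV.r_add_four_le
  unfold denList at h
  rw [List.mem_flatMap] at h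
  obtain ⟨j, hj, hi⟩ := h
  rw [Finset.mem_toList, mem_Icc] at hj
  rw [List.mem_map] at hi
  obtain ⟨l, hl, rfl⟩ := hi
  rw [Finset.mem_toList, mem_Icc] at hl
  have h2j := hV.two_mul_h_lt (j := j) (by omega) hj.2
  have hjr : P.h (P.r + 1) ≤ P.h j := hV.h_mono (by omega) hj.1 hj.2
  exact mem_Icc.2 ⟨by omega, by omega⟩

/-- Every shift occurs at most `q − r` times in `denList`. [cite: Zudilin2004, §8 Lemma 19 (proof)] -/
theorem count_denList_le (P : HParams) (i : ℕ) : P.denList.count i ≤ P.q - P.r := by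
  unfold denList
  rw [List.count_flatMap]
  have h1 : ∀ x ∈ (Icc (P.r + 1) P.q).toList.map
      (List.count i ∘ fun j => ((Icc 0 (P.h 0 - 2 * P.h j)).toList.map fun l => P.h j + l)), x ≤ 1 := by
    intro x hx
    rw [List.mem_map] at hx
    obtain ⟨j, _, rfl⟩ := hx
    refine List.nodup_iff_count_le_one.1 ((Finset.nodup_toList _).map ?_) i
    intro a b hab
    simpa using hab
  refine (List.sum_le_card_nsmul _ 1 h1).trans ?_
  simp [Finset.length_toList]

/-- There are constants `c k s` with `R(t) = Σ_{k ∈ poleSet} Σ_{s=1}^{q−r} c k s (t+k)^{−s}` away from the poles.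
[cite: Zudilin2004, §8 Lemma 19 (proof)] -/
theorem exists_RwpQ_eq_pfEval (hV : P.Valid) : ∃ c : ℕ → ℕ → ℚ, ∀ t : ℚ, (∀ i ∈ P.poleSet, t + i ≠ 0) →
    P.RwpQ t = pfEval P.poleSet (fun _ => P.q - P.r) c t := by
  have hL : ∀ i ∈ P.denList, i ∈ P.poleSet := fun i hi => mem_poleSet_of_mem_denList hV hi
  have hdeg : P.numPoly.natDegree < P.denList.length := by
    have := natDegree_add_two_le_length hV; omega
  obtain ⟨c, hc⟩ := exists_pfEval_eq_eval_mul_prod_inv P.poleSet P.numPoly P.denList hL hdeg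
  have hPF : IsPF P.poleSet (fun i => P.denList.count i) P.RwpQ :=
    ⟨c, fun t ht => (P.RwpQ_eq_eval_mul_prod t).trans (hc t ht)⟩
  obtain ⟨c', hc'⟩ := hPF.mono fun i _ => count_denList_le P i
  exact ⟨c', hc'⟩

/-! ### Identification of the coefficients -/

/-- A punctured neighbourhood of `−k₀` contains no pole and not `−k₀`. [cite: Zudilin2004, §8 Lemma 19 (proof)] -/
theorem eventually_good (P : HParams) (k₀ : ℕ) :
    ∀ᶠ t : ℚ in 𝓝[≠] (-(k₀ : ℚ)), t + k₀ ≠ 0 ∧ ∀ i ∈ P.poleSet, t + i ≠ 0 := by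
  filter_upwards [eventually_ne_poles (P.h (P.r + 1) : ℤ) (P.h 0 - 2 * P.h (P.r + 1) + 1) (k₀ : ℤ)]
    with t ht
  refine ⟨by exact_mod_cast ht.1, fun i hi => ?_⟩
  have hi' := mem_Icc.1 hi
  have h := ht.2 (i - P.h (P.r + 1)) (mem_range.2 (by omega))
  have e : (((P.h (P.r + 1) : ℤ) + ((i - P.h (P.r + 1) : ℕ) : ℤ) : ℤ) : ℚ) = (i : ℚ) := by
    rw [Nat.cast_sub hi'.1]; push_cast; ring
  rwa [e] at h

/-- `Gk P k₀` is continuous at `−k₀` (`k₀ ∈ poleSet`). [cite: Zudilin2004, §8 Lemma 19 (proof)] -/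
theorem continuousAt_Gk (hV : P.Valid) {k₀ : ℕ} (hk₀ : k₀ ∈ P.poleSet) :
    ContinuousAt (P.Gk k₀) (-(k₀ : ℚ)) :=
  (contDiffAt_Gk hV (mem_Icc.1 hk₀).1 (mem_Icc.1 hk₀).2 0).continuousAt

/-- **Identification of the coefficients**: if `R = pfEval poleSet (q−r) c` away from the poles, then for
`k₀ ∈ poleSet` and `a < q − r`, `(1/a!)(Gk P k₀)^{(a)}(−k₀) = c k₀ (q − r − a)`; i.e. the coefficient of
`(t+k₀)^{−s}` is `B P s k₀`. [cite: Zudilin2004, §8 Lemma 19 (proof)] -/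
theorem divDeriv_Gk_eq_coeff (hV : P.Valid) {c : ℕ → ℕ → ℚ}
    (hc : ∀ t : ℚ, (∀ i ∈ P.poleSet, t + i ≠ 0) → P.RwpQ t = pfEval P.poleSet (fun _ => P.q - P.r) c t)
    {k₀ : ℕ} (hk₀ : k₀ ∈ P.poleSet) {a : ℕ} (ha : a < P.q - P.r) :
    divDeriv a (P.Gk k₀) (-(k₀ : ℚ)) = c k₀ (P.q - P.r - a) := by
  set M := P.q - P.r with hM
  -- the regular part `H` and the candidate germ `F`
  set H : ℚ → ℚ := fun t => ∑ i ∈ P.poleSet.erase k₀, ∑ s ∈ Icc 1 M, c i s * ((t + i) ^ s)⁻¹ with hH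
  set F : ℚ → ℚ := fun t => ∑ s ∈ Icc 1 M, c k₀ s * (t - (-(k₀ : ℚ))) ^ (M - s)
    + (t - (-(k₀ : ℚ))) ^ M * H t with hF
  have hHs : ContDiffAt ℚ (⊤ : ℕ∞) H (-(k₀ : ℚ)) := by
    refine ContDiffAt.sum fun i hi => ContDiffAt.sum fun s _ => ?_
    exact contDiffAt_const.mul
      (Literature.NumberTheory.Transcendental.Zudilin2004.contDiffAt_inv_pow (ne_of_mem_erase hi) s)
  have hterm : ∀ s ∈ Icc 1 M, ContDiffAt ℚ (⊤ : ℕ∞)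
      (fun t : ℚ => c k₀ s * (t - (-(k₀ : ℚ))) ^ (M - s)) (-(k₀ : ℚ)) := fun s _ =>
    contDiffAt_const.mul (contDiffAt_sub_pow _ _ _)
  have hFs : ContDiffAt ℚ (⊤ : ℕ∞) F (-(k₀ : ℚ)) :=
    (ContDiffAt.sum fun s hs => hterm s hs).add ((contDiffAt_sub_pow _ _ _).mul hHs)
  -- `Gk = F` near `−k₀`
  have hGF : P.Gk k₀ =ᶠ[𝓝 (-(k₀ : ℚ))] F := by
    refine eventuallyEq_of_nhdsNE (continuousAt_Gk hV hk₀) hFs.continuousAt ?_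
    filter_upwards [eventually_good P k₀] with t ht
    rw [Gk_eq P k₀ ht.1, hc t ht.2, pfEval, ← add_sum_erase _ _ hk₀, hF, hH]
    simp only [sub_neg_eq_add]
    rw [add_mul, sum_mul, mul_comm _ (H t)]
    congr 1
    refine sum_congr rfl fun s hs => ?_
    have hs' := (mem_Icc.1 hs).2
    rw [mul_assoc]
    congr 1
    have hpow : (t + k₀) ^ M = (t + k₀) ^ s * (t + k₀) ^ (M - s) := by
      rw [← pow_add]; congr 1; omega
    rw [hpow, ← mul_assoc, inv_mul_cancel₀ (pow_ne_zero s ht.1), one_mul]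
  -- compute the divided derivative of `F`
  rw [divDeriv_congr hGF, hF]
  have ha' : ContDiffAt ℚ a (fun t => (t - (-(k₀ : ℚ))) ^ M * H t) (-(k₀ : ℚ)) :=
    ((contDiffAt_sub_pow _ _ _).mul hHs).of_le (mod_cast le_top)
  rw [divDeriv_fun_add ((ContDiffAt.sum fun s hs => hterm s hs).of_le (mod_cast le_top)) ha',
    divDeriv_sub_pow_mul (hHs.of_le (mod_cast le_top)) M, if_pos ha, add_zero,
    divDeriv_sum fun s hs => (hterm s hs).of_le (mod_cast le_top)]
  simp_rw [divDeriv_const_mul, divDeriv_sub_pow]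
  rw [sum_eq_single_of_mem (M - a) (mem_Icc.2 ⟨by omega, by omega⟩)]
  · rw [if_pos (by omega), mul_one]
  · intro s hs hsa
    rw [if_neg (by have := mem_Icc.1 hs; omega), mul_zero]

/-- **Partial fractions of `R(t)` with the coefficients `B`** ([Zudilin2004, proof of Lemma 19]:
`R(t) = Σ_{j=r+1}^{q} Σ_k B_{jk}/(t+k)^{j−r}`): away from the poles,
`R(t) = Σ_{k ∈ poleSet} Σ_{s=1}^{q−r} B P s k · ((t+k)^s)⁻¹`. [cite: Zudilin2004, §8 Lemma 19 (proof)] -/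
theorem RwpQ_eq_sum_B (hV : P.Valid) (t : ℚ) (ht : ∀ i ∈ P.poleSet, t + i ≠ 0) :
    P.RwpQ t = ∑ k ∈ P.poleSet, ∑ s ∈ Icc 1 (P.q - P.r), P.B s k * ((t + k) ^ s)⁻¹ := by
  obtain ⟨c, hc⟩ := exists_RwpQ_eq_pfEval hV
  rw [hc t ht, pfEval]
  refine sum_congr rfl fun k hk => sum_congr rfl fun s hs => ?_
  have hs' := mem_Icc.1 hs
  rw [B, divDeriv_Gk_eq_coeff hV hc hk (by omega), show P.q - P.r - (P.q - P.r - s) = s by omega]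

/-! ### The well-poised symmetry (8.5) -/

/-- `∏_{i=1}^{m} (−t + c + i) = (−1)^m ∏_{i=1}^{m} (t + (−c−m−1) + i)` (reflection `i ↦ m+1−i`).
[cite: Zudilin2004, §8 (8.5)] -/
private theorem prod_Icc_one_reflect (m : ℕ) (t c : ℚ) :
    ∏ i ∈ Icc 1 m, (-t + c + i) = (-1) ^ m * ∏ i ∈ Icc 1 m, (t + (-c - m - 1) + i) := by
  have hc : (Icc 1 m).card = m := by simp
  rw [show ((-1 : ℚ) ^ m) = (-1) ^ (Icc 1 m).card by rw [hc], pow_card_mul_prod]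
  refine prod_nbij' (fun i => m + 1 - i) (fun i => m + 1 - i) ?_ ?_ ?_ ?_ ?_
  · intro i hi; have := mem_Icc.1 hi; exact mem_Icc.2 ⟨by omega, by omega⟩
  · intro i hi; have := mem_Icc.1 hi; exact mem_Icc.2 ⟨by omega, by omega⟩
  · intro i hi; have := mem_Icc.1 hi; omega
  · intro i hi; have := mem_Icc.1 hi; omega
  · intro i hi
    have := mem_Icc.1 hi
    rw [Nat.cast_sub (by omega)]
    push_cast
    ring

/-- `∏_{i=0}^{M} (−t + c + i) = (−1)^{M+1} ∏_{i=0}^{M} (t + (−c−M) + i)` (reflection `i ↦ M−i`).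
[cite: Zudilin2004, §8 (8.5)] -/
private theorem prod_Icc_zero_reflect (M : ℕ) (t c : ℚ) :
    ∏ i ∈ Icc 0 M, (-t + c + i) = (-1) ^ (M + 1) * ∏ i ∈ Icc 0 M, (t + (-c - M) + i) := by
  have hc : (Icc 0 M).card = M + 1 := by simp
  rw [show ((-1 : ℚ) ^ (M + 1)) = (-1) ^ (Icc 0 M).card by rw [hc], pow_card_mul_prod]
  refine prod_nbij' (fun i => M - i) (fun i => M - i) ?_ ?_ ?_ ?_ ?_
  · intro i hi; have := mem_Icc.1 hi; exact mem_Icc.2 ⟨by omega, by omega⟩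
  · intro i hi; have := mem_Icc.1 hi; exact mem_Icc.2 ⟨by omega, by omega⟩
  · intro i hi; have := mem_Icc.1 hi; omega
  · intro i hi; have := mem_Icc.1 hi; omega
  · intro i hi
    have := mem_Icc.1 hi
    rw [Nat.cast_sub (by omega)]
    ring

/-- **The well-poised symmetry** (8.5): `R(−t−h₀) = −R(t)` for every rational `t` (both sides vanish at the
poles' reflections only formally: the identity is between rational functions written as the same products).
[cite: Zudilin2004, §8 (8.5)] -/
theorem RwpQ_reflect (hV : P.Valid) (t : ℚ) : P.RwpQ (-t - P.h 0) = -P.RwpQ t := by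
  have hrq := hV.r_add_four_le
  -- the numerator blocks swap, each with the sign `(−1)^{h_j−1}`
  have hA : ∀ j ∈ Icc 1 P.r, ∏ i ∈ Icc 1 (P.h j - 1), (-t - (P.h 0 : ℚ) + i)
      = (-1) ^ (P.h j - 1) * ∏ i ∈ Icc 1 (P.h j - 1), (t + ((P.h 0 - P.h j : ℕ) : ℚ) + i) := by
    intro j hj
    have hj' := mem_Icc.1 hj
    have h1j := hV.one_le_h (j := j) (by omega)
    have h2j := hV.two_mul_h_lt hj'.1 (by omega)
    have h := prod_Icc_one_reflect (P.h j - 1) t (-(P.h 0 : ℚ))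
    rw [show -t + -(P.h 0 : ℚ) = -t - P.h 0 by ring] at h
    rw [h]
    congr 1
    refine prod_congr rfl fun i _ => ?_
    rw [Nat.cast_sub (by omega : P.h j ≤ P.h 0), Nat.cast_sub h1j]
    push_cast
    ring
  have hB : ∀ j ∈ Icc 1 P.r, ∏ i ∈ Icc 1 (P.h j - 1), (-t - (P.h 0 : ℚ) + ((P.h 0 - P.h j : ℕ) : ℚ) + i)
      = (-1) ^ (P.h j - 1) * ∏ i ∈ Icc 1 (P.h j - 1), (t + i) := by
    intro j hj
    have hj' := mem_Icc.1 hj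
    have h1j := hV.one_le_h (j := j) (by omega)
    have h2j := hV.two_mul_h_lt hj'.1 (by omega)
    have h := prod_Icc_one_reflect (P.h j - 1) t (-(P.h 0 : ℚ) + ((P.h 0 - P.h j : ℕ) : ℚ))
    rw [show -t + (-(P.h 0 : ℚ) + ((P.h 0 - P.h j : ℕ) : ℚ)) = -t - P.h 0 + ((P.h 0 - P.h j : ℕ) : ℚ) by ring]
      at h
    rw [h]
    congr 1
    refine prod_congr rfl fun i _ => ?_
    rw [Nat.cast_sub (by omega : P.h j ≤ P.h 0), Nat.cast_sub h1j]
    push_cast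
    ring
  -- each denominator block is reflected onto itself, with the sign `(−1)^{h₀−2h_j+1}`
  have hC : ∀ j ∈ Icc (P.r + 1) P.q, ∏ i ∈ Icc 0 (P.h 0 - 2 * P.h j), (-t - (P.h 0 : ℚ) + P.h j + i)
      = (-1) ^ (P.h 0 - 2 * P.h j + 1) * ∏ i ∈ Icc 0 (P.h 0 - 2 * P.h j), (t + P.h j + i) := by
    intro j hj
    have hj' := mem_Icc.1 hj
    have h2j := hV.two_mul_h_lt (j := j) (by omega) hj'.2
    have h := prod_Icc_zero_reflect (P.h 0 - 2 * P.h j) t (-(P.h 0 : ℚ) + P.h j)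
    rw [show -t + (-(P.h 0 : ℚ) + P.h j) = -t - P.h 0 + P.h j by ring] at h
    rw [h]
    congr 1
    refine prod_congr rfl fun i _ => ?_
    rw [Nat.cast_sub h2j.le]
    push_cast
    ring
  -- the signs
  have hS : (∏ j ∈ Icc 1 P.r, ((-1 : ℚ) ^ (P.h j - 1))) * ∏ j ∈ Icc 1 P.r, ((-1 : ℚ) ^ (P.h j - 1)) = 1 := by
    rw [← prod_mul_distrib]
    refine prod_eq_one fun j _ => ?_
    rw [← pow_add, ← two_mul, pow_mul, neg_one_sq, one_pow]
  have hT : ∏ j ∈ Icc (P.r + 1) P.q, ((-1 : ℚ) ^ (P.h 0 - 2 * P.h j + 1)) = 1 := by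
    have e : ∀ j ∈ Icc (P.r + 1) P.q, ((-1 : ℚ) ^ (P.h 0 - 2 * P.h j + 1)) = (-1) ^ (P.h 0 + 1) := by
      intro j hj
      have h2j := hV.two_mul_h_lt (j := j) (by have := mem_Icc.1 hj; omega) (mem_Icc.1 hj).2
      rw [neg_one_pow_eq_pow_mod_two (R := ℚ), neg_one_pow_eq_pow_mod_two (R := ℚ) (n := P.h 0 + 1)]
      congr 1
      omega
    rw [prod_congr rfl e, prod_const, Nat.card_Icc, show P.q + 1 - (P.r + 1) = P.q - P.r by omega,
      ← pow_mul, mul_comm, pow_mul, (hV.even_q_sub_r.neg_one_pow : ((-1 : ℚ) ^ (P.q - P.r)) = 1), one_pow]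
  have hA' : ∏ j ∈ Icc 1 P.r, (∏ i ∈ Icc 1 (P.h j - 1), (-t - (P.h 0 : ℚ) + i)) / ((P.h j - 1)! : ℚ)
      = (∏ j ∈ Icc 1 P.r, ((-1 : ℚ) ^ (P.h j - 1))) *
        ∏ j ∈ Icc 1 P.r, (∏ i ∈ Icc 1 (P.h j - 1), (t + ((P.h 0 - P.h j : ℕ) : ℚ) + i)) / ((P.h j - 1)! : ℚ) := by
    rw [← prod_mul_distrib]
    refine prod_congr rfl fun j hj => ?_
    rw [hA j hj, mul_div_assoc]
  have hB' : ∏ j ∈ Icc 1 P.r,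
      (∏ i ∈ Icc 1 (P.h j - 1), (-t - (P.h 0 : ℚ) + ((P.h 0 - P.h j : ℕ) : ℚ) + i)) / ((P.h j - 1)! : ℚ)
      = (∏ j ∈ Icc 1 P.r, ((-1 : ℚ) ^ (P.h j - 1))) *
        ∏ j ∈ Icc 1 P.r, (∏ i ∈ Icc 1 (P.h j - 1), (t + i)) / ((P.h j - 1)! : ℚ) := by
    rw [← prod_mul_distrib]
    refine prod_congr rfl fun j hj => ?_
    rw [hB j hj, mul_div_assoc]
  have hC' : ∏ j ∈ Icc (P.r + 1) P.q,
      ((P.h 0 - 2 * P.h j)! : ℚ) / ∏ i ∈ Icc 0 (P.h 0 - 2 * P.h j), (-t - (P.h 0 : ℚ) + P.h j + i)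
      = ∏ j ∈ Icc (P.r + 1) P.q, ((P.h 0 - 2 * P.h j)! : ℚ) / ∏ i ∈ Icc 0 (P.h 0 - 2 * P.h j), (t + P.h j + i) := by
    rw [← one_mul (∏ j ∈ Icc (P.r + 1) P.q,
      ((P.h 0 - 2 * P.h j)! : ℚ) / ∏ i ∈ Icc 0 (P.h 0 - 2 * P.h j), (t + P.h j + i)), ← inv_one, ← hT,
      ← prod_inv_distrib, ← prod_mul_distrib]
    refine prod_congr rfl fun j hj => ?_
    rw [hC j hj, mul_comm ((-1 : ℚ) ^ _) _, ← div_div, div_eq_mul_inv _ ((-1 : ℚ) ^ _), mul_comm]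
  unfold RwpQ
  rw [hA', hB', hC']
  linear_combination (-((P.h 0 : ℚ) + 2 * t) *
    (∏ j ∈ Icc 1 P.r, (∏ i ∈ Icc 1 (P.h j - 1), (t + i)) / ((P.h j - 1)! : ℚ)) *
    (∏ j ∈ Icc 1 P.r, (∏ i ∈ Icc 1 (P.h j - 1), (t + ((P.h 0 - P.h j : ℕ) : ℚ) + i)) / ((P.h j - 1)! : ℚ)) *
    ∏ j ∈ Icc (P.r + 1) P.q,
      ((P.h 0 - 2 * P.h j)! : ℚ) / ∏ i ∈ Icc 0 (P.h 0 - 2 * P.h j), (t + P.h j + i)) * hS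

/-- Near `−(h₀−k)`: `Gk P (h₀−k) t = −Gk P k (−h₀−t)` (`k ∈ poleSet`; `q − r` is even). [cite: Zudilin2004, §8 (8.5)] -/
theorem Gk_reflect_eventuallyEq (hV : P.Valid) {k : ℕ} (hk : k ∈ P.poleSet) :
    P.Gk (P.h 0 - k) =ᶠ[𝓝 (-((P.h 0 - k : ℕ) : ℚ))] fun t => -P.Gk k (-(P.h 0 : ℚ) - t) := by
  have hk' := mem_Icc.1 hk
  have hcast : ((P.h 0 - k : ℕ) : ℚ) = (P.h 0 : ℚ) - k := by
    rw [Nat.cast_sub (by omega)]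
  -- continuity of both sides
  have hc1 : ContinuousAt (P.Gk (P.h 0 - k)) (-((P.h 0 - k : ℕ) : ℚ)) :=
    continuousAt_Gk hV (reflect_mem_poleSet hk)
  have hc2 : ContinuousAt (fun t : ℚ => -P.Gk k (-(P.h 0 : ℚ) - t)) (-((P.h 0 - k : ℕ) : ℚ)) := by
    have hG : ContinuousAt (P.Gk k) (-(k : ℚ)) := continuousAt_Gk hV hk
    have haff : ContinuousAt (fun t : ℚ => -(P.h 0 : ℚ) - t) (-((P.h 0 - k : ℕ) : ℚ)) :=
      (continuous_const.sub continuous_id).continuousAt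
    have hpt : -(P.h 0 : ℚ) - -((P.h 0 - k : ℕ) : ℚ) = -(k : ℚ) := by
      rw [hcast]; ring
    exact (ContinuousAt.comp (g := P.Gk k) (by rw [hpt]; exact hG) haff).neg
  refine eventuallyEq_of_nhdsNE hc1 hc2 ?_
  filter_upwards [eventually_good P (P.h 0 - k)] with t ht
  have ht1 : t + ((P.h 0 - k : ℕ) : ℚ) ≠ 0 := ht.1
  have ht2 : -(P.h 0 : ℚ) - t + k ≠ 0 := by
    intro h; apply ht1; rw [hcast]; linarith
  rw [Gk_eq P (P.h 0 - k) ht1, Gk_eq P k ht2, show -(P.h 0 : ℚ) - t = -t - P.h 0 by ring,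
    RwpQ_reflect hV, hcast]
  have : (-t - (P.h 0 : ℚ) + k) = -(t + ((P.h 0 : ℚ) - k)) := by ring
  rw [this, neg_pow, hV.even_q_sub_r.neg_one_pow, one_mul]
  ring

/-- **Well-poised symmetry of the coefficients**: `B P s (h₀−k) = (−1)^{s+1} B P s k` for `k ∈ poleSet`,
`s ≤ q − r` ([Zudilin2004, proof of Lemma 19]: `B_{jk} = (−1)^j B_{j,h₀−k}`, `j = s + r`, `r` odd).
[cite: Zudilin2004, §8 Lemma 19 (proof)] -/
theorem B_symm (hV : P.Valid) {k s : ℕ} (hk : k ∈ P.poleSet) (hs : s ≤ P.q - P.r) :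
    P.B s (P.h 0 - k) = (-1) ^ (s + 1) * P.B s k := by
  have hk' := mem_Icc.1 hk
  obtain ⟨c, hc⟩ := hV.even_q_sub_r
  unfold B
  rw [divDeriv_congr (Gk_reflect_eventuallyEq hV hk), divDeriv_neg]
  have hfun : (fun t : ℚ => P.Gk k (-(P.h 0 : ℚ) - t))
      = fun t => (fun u => P.Gk k (-u)) (t + (P.h 0 : ℚ)) := by
    funext t; simp only; congr 1; ring
  rw [hfun, show divDeriv (P.q - P.r - s) (fun t => (fun u => P.Gk k (-u)) (t + (P.h 0 : ℚ)))
      (-((P.h 0 - k : ℕ) : ℚ)) = divDeriv (P.q - P.r - s) (fun u => P.Gk k (-u))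
      (-((P.h 0 - k : ℕ) : ℚ) + (P.h 0 : ℚ)) from
      divDeriv_comp_add_const (P.q - P.r - s) (fun u => P.Gk k (-u)) (P.h 0 : ℚ) (-((P.h 0 - k : ℕ) : ℚ)),
    divDeriv_comp_neg]
  have hpt : -(-((P.h 0 - k : ℕ) : ℚ) + (P.h 0 : ℚ)) = -(k : ℚ) := by
    rw [Nat.cast_sub (by omega)]; ring
  rw [hpt]
  have hsign : -((-1 : ℚ) ^ (P.q - P.r - s)) = (-1) ^ (s + 1) := by
    rw [neg_eq_neg_one_mul, ← pow_succ', neg_one_pow_eq_pow_mod_two,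
      neg_one_pow_eq_pow_mod_two (R := ℚ) (n := s + 1)]
    congr 1
    omega
  rw [← neg_mul, hsign]

/-- **The coefficients of the even zeta values vanish**: `Σ_{k ∈ poleSet} B P s k = 0` for even `s ≤ q − r`
([Zudilin2004, proof of Lemma 19]: `A_{j−1} = 0` for odd `j`, by (8.5) and (8.12)). [cite: Zudilin2004, §8 Lemma 19 (proof), (8.12)] -/
theorem sum_B_eq_zero_of_even (hV : P.Valid) {s : ℕ} (hs : s ≤ P.q - P.r) (heven : Even s) :
    ∑ k ∈ P.poleSet, P.B s k = 0 := by
  have hrefl : ∑ k ∈ P.poleSet, P.B s k = ∑ k ∈ P.poleSet, P.B s (P.h 0 - k) := by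
    refine sum_nbij' (fun k => P.h 0 - k) (fun k => P.h 0 - k) ?_ ?_ ?_ ?_ ?_
    · intro k hk; exact reflect_mem_poleSet hk
    · intro k hk; exact reflect_mem_poleSet hk
    · intro k hk; have := mem_Icc.1 hk; omega
    · intro k hk; have := mem_Icc.1 hk; omega
    · intro k hk
      have := mem_Icc.1 hk
      rw [show P.h 0 - (P.h 0 - k) = k by omega]
  have hneg : ∑ k ∈ P.poleSet, P.B s (P.h 0 - k) = -∑ k ∈ P.poleSet, P.B s k := by
    rw [← sum_neg_distrib]
    refine sum_congr rfl fun k hk => ?_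
    rw [B_symm hV hk hs]
    have : ((-1 : ℚ) ^ (s + 1)) = -1 := by
      rw [pow_succ, heven.neg_one_pow, one_mul]
    rw [this]
    ring
  have h := hrefl.trans hneg
  linarith

end HParams

end Literature.NumberTheory.Irrationality.Zudilin2004
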